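import Summits.KontsevichZagierPeriods.KontsevichZagierPeriods.Theorems.LinRedNormalFormHoffmanIndependenceRungs

/-!
# Crux `HoffmanIndependence` (stmt-KontsevichZagierPeriods-15045), line `weight_split` —
# rung `N = 4` of `stub_weightGrading`, typed

`Theorems/LinRedNormalFormHoffmanIndependenceRungs.lean` shows that
`stub_weightGrading : iSupIndep hoffmanSpan` is exactly the conjunction of its rungs
`iSupIndep (hoffmanSpan n)_{n ≤ N}`, proves the rungs `N ≤ 2`, and types the first open rung
`N = 3` as `ζ(3) ∉ ℚ + ℚπ²` (`weightGrading_initial_three_iff_zeta_three`). This file types the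
next rung `N = 4`. The Hoffman spans of weights `0, …, 4` are the lines (or zero)
`ℚ · 1`, `0`, `ℚ · ζ(2) = ℚ · π²`, `ℚ · ζ(3)`, `ℚ · π⁴` (`hoffmanSpan 4 = ℚ · ζ(2,2) = ℚ · π⁴`,
`hoffmanSpan_four_eq_span_pi_pow_four`), so

* `weightGrading_initial_four_iff` — rung `N = 4` holds iff the four real numbers
  `1, π², π⁴, ζ(3)` are `ℚ`-linearly independent;
* `weightGrading_initial_four_iff_zeta_three` — since `1, π², π⁴` are already independent
  (powers of the transcendental number `π`, Lindemann), rung `N = 4` is EXACTLY the elementary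
  open statement `ζ(3) ∉ ℚ + ℚπ² + ℚπ⁴`.

No new definitions; nothing here closes the item. [cite: Zagier1994, §9] [cite: Lindemann1882]
[cite: Apery1979]
-/

noncomputable section

namespace Summit.KontsevichZagierPeriods.LinRedNormalForm.HoffmanIndependence

open Literature.NumberTheory.Transcendental MZV
open Summit.KontsevichZagierPeriods.HoffmanIndependence.Negative (linearIndependent_pow_of_transcendental)

/-! ## The weight-`2` Hoffman span as the line `ℚ · π²` -/

/-- `hoffmanSpan 2 = ℚ · π²` (`hoffmanSpan 2 = ℚ · ζ(2)` and `ζ(2) = π²/6`). [folklore] -/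
theorem hoffmanSpan_two_eq_span_pi_sq : hoffmanSpan 2 = ℚ ∙ (Real.pi ^ 2) := by
  rw [hoffmanSpan_two_eq_span]
  refine le_antisymm ((Submodule.span_singleton_le_iff_mem _ _).2 multipleZeta_two_mem_span_pi_sq)
    ((Submodule.span_singleton_le_iff_mem _ _).2 ?_)
  rw [Submodule.mem_span_singleton]
  refine ⟨(6 : ℚ), ?_⟩
  rw [multipleZeta_two, Rat.smul_def]
  push_cast
  ring

/-- `1, π², π⁴` are `ℚ`-linearly independent: the powers `π⁰, π², π⁴` of the transcendental
number `π` (`transcendental_pi_holds`). [cite: Lindemann1882] -/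
theorem linearIndependent_one_pi_sq_pi_pow_four :
    LinearIndependent ℚ ![(1 : ℝ), Real.pi ^ 2, Real.pi ^ 4] := by
  have hpow : LinearIndependent ℚ (fun m : ℕ => Real.pi ^ m) :=
    linearIndependent_pow_of_transcendental transcendental_pi_holds
  have h := hpow.comp (![0, 2, 4] : Fin 3 → ℕ)
    (by intro i j hij; fin_cases i <;> fin_cases j <;> simp_all)
  convert h using 1
  funext i
  fin_cases i <;> simp

/-! ## Rung `N = 4` of stub 1, typed -/

/-- The four non-zero Hoffman weights `0, 2, 4, 3` inside `{n ≤ 4}`. [folklore] -/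
theorem initialFour_injective :
    Function.Injective (![⟨0, by norm_num⟩, ⟨2, by norm_num⟩, ⟨4, by norm_num⟩, ⟨3, by norm_num⟩] :
      Fin 4 → {n : ℕ // n ≤ 4}) := by
  intro i j hij
  fin_cases i <;> fin_cases j <;> simp_all

/-- **RUNG `N = 4` OF STUB 1, typed**: the Hoffman spans of weights `≤ 4` (`ℚ`, `0`, `ℚπ²`,
`ℚζ(3)`, `ℚπ⁴`) are independent iff the four real numbers `1, π², π⁴, ζ(3)` are `ℚ`-linearly
independent (each span is the line through the corresponding number, `hoffmanSpan 1 = 0`).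
[cite: Zagier1994, §9] -/
theorem weightGrading_initial_four_iff :
    iSupIndep (fun n : {n : ℕ // n ≤ 4} => hoffmanSpan n.1) ↔
      LinearIndependent ℚ ![(1 : ℝ), Real.pi ^ 2, Real.pi ^ 4, multipleZeta [3]] := by
  have hne : ∀ i : Fin 4, ![(1 : ℝ), Real.pi ^ 2, Real.pi ^ 4, multipleZeta [3]] i ≠ 0 := by
    intro i
    fin_cases i
    · simp
    · simp [Real.pi_ne_zero]
    · simp [Real.pi_ne_zero]
    · simpa using multipleZeta_three_ne_zero
  constructor
  · intro h
    rw [← iSupIndep_iff_linearIndependent_of_ne_zero hne]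
    have h4 := h.comp initialFour_injective
    convert h4 using 1
    funext i
    fin_cases i
    · simp [hoffmanSpan_zero_eq_span_one]
    · simp [hoffmanSpan_two_eq_span_pi_sq]
    · simp [hoffmanSpan_four_eq_span_pi_pow_four]
    · simp [hoffmanSpan_three_eq_span]
  · intro hv
    refine iSupIndep_of_le_span_singleton hv
      (fun n => if n.1 = 0 then (0 : Fin 4) else if n.1 = 2 then 1 else if n.1 = 4 then 2 else 3)
      ?_ ?_
    · rintro ⟨a, ha4⟩ ha ⟨b, hb4⟩ hb hab
      simp only [ne_eq, Set.mem_setOf_eq] at ha hb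
      have ha1 : a ≠ 1 := by rintro rfl; exact ha hoffmanSpan_one_eq_bot
      have hb1 : b ≠ 1 := by rintro rfl; exact hb hoffmanSpan_one_eq_bot
      apply Subtype.ext
      show a = b
      interval_cases a <;> interval_cases b <;> first | rfl | (exfalso; simp at hab ha1 hb1)
    · rintro ⟨n, hn4⟩
      interval_cases n
      · simp [hoffmanSpan_zero_eq_span_one]
      · rw [hoffmanSpan_one_eq_bot]
        exact bot_le
      · simp [hoffmanSpan_two_eq_span_pi_sq]
      · simp [hoffmanSpan_three_eq_span]
      · simp [hoffmanSpan_four_eq_span_pi_pow_four]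

/-- **RUNG `N = 4` OF STUB 1 = `ζ(3) ∉ ℚ + ℚπ² + ℚπ⁴`.** Since `1, π², π⁴` are already
independent (`linearIndependent_one_pi_sq_pi_pow_four`, Lindemann) and the Hoffman spans of
weights `0, 2, 3, 4` are the lines through `1, π², ζ(3), π⁴`, the rung `N = 4` of
`stub_weightGrading` is exactly the statement that `ζ(3)` is not of the form `a + bπ² + cπ⁴` with
`a, b, c ∈ ℚ` (open: Apéry gives `ζ(3) ∉ ℚ` only). [cite: Zagier1994, §9] -/
theorem weightGrading_initial_four_iff_zeta_three :
    iSupIndep (fun n : {n : ℕ // n ≤ 4} => hoffmanSpan n.1) ↔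
      ∀ a b c : ℚ, multipleZeta [3] ≠ a + b * Real.pi ^ 2 + c * Real.pi ^ 4 := by
  rw [weightGrading_initial_four_iff, linearIndependent_finSucc']
  have hinit : Fin.init ![(1 : ℝ), Real.pi ^ 2, Real.pi ^ 4, multipleZeta [3]] =
      ![(1 : ℝ), Real.pi ^ 2, Real.pi ^ 4] := by
    funext i
    fin_cases i <;> rfl
  rw [hinit]
  simp only [linearIndependent_one_pi_sq_pi_pow_four, true_and]
  have hlast : ![(1 : ℝ), Real.pi ^ 2, Real.pi ^ 4, multipleZeta [3]] (Fin.last 3) =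
      multipleZeta [3] := rfl
  rw [hlast, Submodule.mem_span_range_iff_exists_fun, not_exists]
  constructor
  · intro h a b c habc
    refine h ![a, b, c] ?_
    rw [Fin.sum_univ_three]
    simp only [Matrix.cons_val_zero, Matrix.cons_val_one, Matrix.cons_val_two, Matrix.head_cons,
      Matrix.tail_cons, Rat.smul_def, habc]
    ring
  · intro h d hd
    refine h (d 0) (d 1) (d 2) ?_
    rw [Fin.sum_univ_three] at hd
    simp only [Matrix.cons_val_zero, Matrix.cons_val_one, Matrix.cons_val_two, Matrix.head_cons,
      Matrix.tail_cons, Rat.smul_def] at hd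
    rw [← hd]
    ring

end Summit.KontsevichZagierPeriods.LinRedNormalForm.HoffmanIndependence
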